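import Literature.NumberTheory.LFunctions.BettinConreyFarmer2013ZeroSums
import Literature.NumberTheory.LFunctions.InvZetaVeryGoodHeights
import Literature.NumberTheory.LFunctions.ZetaDerivReciprocalSeries
import Literature.NumberTheory.LFunctions.MoebiusRieszPerron
import Literature.Analysis.Complex.VerticalStripResidues
import Literature.Analysis.Complex.PerronDirichletSeries
import HarnessLib

/-!
# Bettin–Conrey–Farmer 2013, Theorem 1 — the explicit formula for `V_N` (Lemma 2, under RH)

Topic `Literature/NumberTheory/LFunctions`; third "Proofs" companion of
`BettinConreyFarmer2013.lean`. Everything here is PROVED. For the Levinson–Conrey polynomial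
`V_N(s) = ∑_{n ≤ N} (1 − log n/log N) μ(n) n^{-s}` (`levinsonMollifier N`) the paper's Lemma 2 is
the explicit formula
`V_N(s) = ζ(s)⁻¹(1 − ζ'/ζ(s)/log N) + (log N)⁻¹ ∑_ρ N^{ρ−s}/(ζ'(ρ)(ρ−s)²) + (log N)⁻¹ F_s(1/N)`
(there unconditionally, with `F_s` an explicit series over the trivial zeros). We prove the version
that the proof of Theorem 1 uses, under RH, simple zeros and condition (2) (which make the sum
over the zeros absolutely convergent), with the line of integration left at `Re z = 1/4` instead
of being pushed to `−∞`:

  `log N · V_N(s) = log N/ζ(s) − ζ'(s)/ζ(s)² + Z_N(s) + E_N(s)`  (`BCF.levinson_explicit`),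

for `1/4 < Re s < 1`, `Re s ≠ 1/2`, where `Z_N(s) = ∑_ρ N^{ρ−s}/(ζ'(ρ)(ρ−s)²)` (`BCF.zeroSum`) and
`E_N(s) = (2π)⁻¹ ∫ N^{z−s} ζ(z)⁻¹ (z−s)⁻² dy` over `z = 1/4 + iy` (`BCF.leftLineTerm`), together with
the bounds `‖E_N(s)‖ ≤ K N^{1/4 − Re s}` and `‖Z_N(s)‖ ≤ N^{1/2 − Re s} ∑_ρ 1/(|ζ'(ρ)||ρ−s|²)`.

Proof (the paper's, §3 proof of Lemma 2, with the contour truncated at `Re z = 1/4`):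
Perron's formula with the second-order kernel, `log N · V_N(s) = (2πi)⁻¹ ∫_{(Re s + 1)}
N^{z−s} ζ(z)⁻¹ (z−s)⁻² dz` (`Literature.Analysis.Complex.integral_dirichletSeries_mul_perronPow`,
`m = 1`), then the residue theorem between `Re z = Re s + 1` and `Re z = 1/4`
(`Literature.Analysis.Complex.integral_vertical_sub_eq_tsum_of_doublePoles`) across the double
pole `z = s` (residue `log N/ζ(s) − ζ'(s)/ζ(s)²`) and the simple poles at the zeros (residues
`N^{ρ−s}/(ζ'(ρ)(ρ−s)²)`), the horizontal sides being taken at the very good heights of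
`Literature.NumberTheory.LFunctions.VeryGoodHeights.exists_norm_inv_zeta_le_rpow`
(`1/ζ(x ± iT) ≪ T` there, against the kernel's `T⁻²`).

## References

* S. Bettin, J. B. Conrey, D. W. Farmer, Proc. Steklov Inst. Math. 280 (2013), suppl. 2
  (arXiv:1211.5191), §3, Lemma 2 and its proof. [BettinConreyFarmer2013]
-/

noncomputable section

open Complex Filter Set Real MeasureTheory
open scoped Topology ComplexConjugate

namespace Literature.NumberTheory.LFunctions

namespace BCF

open Literature.Barriers.RiemannHypothesis (levinsonMollifier)
open MertensBoundRH (zetaInv zetaInv_of_ne_one)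
open Literature.Analysis.Complex (perronPow)

/-! ## The objects -/

/-- The Perron integrand of Lemma 2: `Φ_{N,s}(z) = N^{z−s} ζ(z)⁻¹ (z−s)⁻²` (with `ζ⁻¹` continued
through the pole of `ζ` by `zetaInv 1 = 0`). [cite: BettinConreyFarmer2013, §3, proof of Lemma 2] -/
def perronIntegrand (N : ℕ) (s z : ℂ) : ℂ := (N : ℂ) ^ (z - s) * zetaInv z / (z - s) ^ 2

/-- The sum over the zeros: `Z_N(s) = ∑_ρ N^{ρ−s}/(ζ'(ρ)(ρ−s)²)` over the distinct non-trivial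
zeros (the paper's `∑_ρ R_N(ρ,s)` for simple zeros). [cite: BettinConreyFarmer2013, §3, Lemma 2] -/
def zeroSum (N : ℕ) (s : ℂ) : ℂ :=
  ∑' ρ : ZetaZeros.riemannZetaNontrivialZeros,
    (N : ℂ) ^ ((ρ : ℂ) - s) / (deriv riemannZeta ρ * ((ρ : ℂ) - s) ^ 2)

/-- The left-line term `E_N(s) = (2π)⁻¹ ∫ Φ_{N,s}(1/4 + iy) dy` (replacing the paper's series
`F_s(1/N)` over the trivial zeros). [cite: BettinConreyFarmer2013, §3, Lemma 2] -/
def leftLineTerm (N : ℕ) (s : ℂ) : ℂ :=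
  (1 / (2 * π) : ℂ) * ∫ y : ℝ, perronIntegrand N s (1 / 4 + y * I)

/-! ## Perron's formula for `log N · V_N(s)` -/

/-- `log N · (1 − log n/log N) = log(N/n)` for `1 ≤ n`, `2 ≤ N`. [folklore] -/
theorem log_mul_weight {N n : ℕ} (hN : 2 ≤ N) (hn : 1 ≤ n) :
    Real.log N * (1 - Real.log n / Real.log N) = Real.log ((N : ℝ) / n) := by
  have hL : Real.log N ≠ 0 := by
    have : (1 : ℝ) < N := by exact_mod_cast hN
    exact (Real.log_pos this).ne'
  rw [Real.log_div (by positivity) (by positivity)]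
  field_simp

/-- `log N · V_N(s) = ∑_{n ≤ N} μ(n) log(N/n) n^{-s}`. [cite: BettinConreyFarmer2013, §1 (definition of V_N)] -/
theorem log_mul_levinsonMollifier {N : ℕ} (hN : 2 ≤ N) (s : ℂ) :
    (Real.log N : ℂ) * levinsonMollifier N s =
      ∑ n ∈ Finset.Icc 1 N, ((ArithmeticFunction.moebius n : ℤ) : ℂ) *
        ((Real.log ((N : ℝ) / n) : ℝ) : ℂ) * (n : ℂ) ^ (-s) := by
  rw [levinsonMollifier, Finset.mul_sum]
  refine Finset.sum_congr rfl fun n hn ↦ ?_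
  have hn1 : 1 ≤ n := (Finset.mem_Icc.1 hn).1
  rw [← log_mul_weight hN hn1]
  push_cast
  ring

/-- **Perron's formula for `log N · V_N(s)`**: for `Re s > 0`,
`∫ Φ_{N,s}(Re s + 1 + iy) dy = 2π log N · V_N(s)`. [cite: BettinConreyFarmer2013, §3, proof of Lemma 2 (first display)] -/
theorem integral_perronIntegrand_right {N : ℕ} (hN : 2 ≤ N) {s : ℂ} (hσ : 0 < s.re) :
    ∫ y : ℝ, perronIntegrand N s ((s.re + 1 : ℝ) + y * I) =
      2 * π * ((Real.log N : ℂ) * levinsonMollifier N s) := by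
  set a : ℕ → ℂ := fun d ↦ ((ArithmeticFunction.moebius d : ℤ) : ℂ) * (d : ℂ) ^ (1 - s) with ha
  have hN0 : (0 : ℝ) < N := by exact_mod_cast (show 0 < N by omega)
  -- summability of `‖a d‖/d²`
  have hsum : Summable fun d : ℕ ↦ ‖a d‖ / (d : ℝ) ^ 2 := by
    have hp : Summable fun d : ℕ ↦ (d : ℝ) ^ (-1 - s.re) :=
      Real.summable_nat_rpow.2 (by linarith)
    refine Summable.of_nonneg_of_le (fun d ↦ by positivity) (fun d ↦ ?_) hp
    rcases Nat.eq_zero_or_pos d with rfl | hd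
    · simp only [ha, Nat.cast_zero]
      simp
      exact Real.rpow_nonneg le_rfl _
    · have hd0 : (0 : ℝ) < d := by exact_mod_cast hd
      rw [ha]
      simp only [norm_mul]
      rw [Complex.norm_natCast_cpow_of_pos hd, sub_re, one_re]
      have hμ : ‖((ArithmeticFunction.moebius d : ℤ) : ℂ)‖ ≤ 1 := RieszPerron.norm_moebius_le d
      calc ‖((ArithmeticFunction.moebius d : ℤ) : ℂ)‖ * (d : ℝ) ^ (1 - s.re) / (d : ℝ) ^ 2
          ≤ 1 * (d : ℝ) ^ (1 - s.re) / (d : ℝ) ^ 2 := by gcongr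
        _ = (d : ℝ) ^ (-1 - s.re) := by
            rw [one_mul, show ((d : ℝ) ^ 2) = (d : ℝ) ^ (2 : ℝ) by norm_cast,
              ← Real.rpow_sub hd0]
            ring_nf
  have hP := Literature.Analysis.Complex.integral_dirichletSeries_mul_perronPow hsum hN0
    (m := 1) le_rfl
  -- identify the integrand with `Φ_{N,s}` on the line `Re z = Re s + 1`
  have hline : ∀ t : ℝ, (∑' d : ℕ, a d / (d : ℂ) ^ (1 + (((1 : ℝ) : ℂ) + t * I))) *
      perronPow N 1 (((1 : ℝ) : ℂ) + t * I) = perronIntegrand N s ((s.re + 1 : ℝ) + (s.im + t) * I) := by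
    intro t
    have hz : ((s.re + 1 : ℝ) : ℂ) + (s.im + t) * I = s + (((1 : ℝ) : ℂ) + t * I) := by
      conv_rhs => rw [← Complex.re_add_im s]
      push_cast; ring
    have hre : 1 < (s + (((1 : ℝ) : ℂ) + t * I)).re := by simp; linarith
    have hne : s + (((1 : ℝ) : ℂ) + t * I) ≠ 1 := by
      intro h; have := congrArg Complex.re h; simp at this; linarith
    rw [hz, perronIntegrand, add_sub_cancel_left, zetaInv_of_ne_one hne,
      ← RieszPerron.LSeries_moebius_eq_inv hre, LSeries]
    have hterm : ∀ d : ℕ, a d / (d : ℂ) ^ (1 + (((1 : ℝ) : ℂ) + t * I)) =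
        LSeries.term (fun n : ℕ ↦ ((ArithmeticFunction.moebius n : ℤ) : ℂ)) (s + (((1 : ℝ) : ℂ) + t * I)) d := by
      intro d
      rcases Nat.eq_zero_or_pos d with rfl | hd
      · simp [ha, LSeries.term]
      · have hd0 : (d : ℂ) ≠ 0 := by exact_mod_cast hd.ne'
        rw [LSeries.term_of_ne_zero hd.ne', ha]
        simp only
        rw [mul_div_assoc]
        congr 1
        rw [← Complex.cpow_sub _ _ hd0, ← Complex.cpow_neg]
        congr 1
        ring
    rw [tsum_congr hterm, perronPow]
    push_cast
    ring
  have hLHS : ∫ t : ℝ, (∑' d : ℕ, a d / (d : ℂ) ^ (1 + (((1 : ℝ) : ℂ) + t * I))) *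
      perronPow N 1 (((1 : ℝ) : ℂ) + t * I) = ∫ y : ℝ, perronIntegrand N s ((s.re + 1 : ℝ) + y * I) := by
    rw [integral_congr_ae (Eventually.of_forall hline)]
    have := integral_add_left_eq_self (μ := volume)
      (fun y : ℝ ↦ perronIntegrand N s ((s.re + 1 : ℝ) + y * I)) s.im
    simpa using this
  rw [← hLHS, hP, log_mul_levinsonMollifier hN, Nat.floor_natCast]
  congr 1
  refine Finset.sum_congr rfl fun d hd ↦ ?_
  have hd1 : 1 ≤ d := (Finset.mem_Icc.1 hd).1
  have hd0 : (d : ℂ) ≠ 0 := by exact_mod_cast (show d ≠ 0 by omega)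
  rw [ha]
  simp only [pow_one, Nat.factorial_one, Nat.cast_one, div_one]
  rw [show ((ArithmeticFunction.moebius d : ℤ) : ℂ) * (d : ℂ) ^ (1 - s) / (d : ℂ) =
    ((ArithmeticFunction.moebius d : ℤ) : ℂ) * ((d : ℂ) ^ (1 - s) / (d : ℂ) ^ (1 : ℂ)) by
      rw [Complex.cpow_one]; ring,
    ← Complex.cpow_sub _ _ hd0]
  ring_nf

/-! ## Analytic inputs: `Φ_{N,s}` off its poles, and the terms at the zeros -/

/-- `z ↦ N^{z−s}` is entire. [folklore] -/
theorem differentiable_natCast_cpow_sub {N : ℕ} (hN : 2 ≤ N) (s : ℂ) :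
    Differentiable ℂ fun z : ℂ ↦ (N : ℂ) ^ (z - s) := by
  intro z
  have hN0 : (N : ℂ) ≠ 0 := by exact_mod_cast (show N ≠ 0 by omega)
  exact (((hasDerivAt_id z).sub_const s).const_cpow (Or.inl hN0)).differentiableAt

/-- `‖N^{z−s}‖ = N^{Re z − Re s}`. [folklore] -/
theorem norm_natCast_cpow_sub {N : ℕ} (hN : 2 ≤ N) (s z : ℂ) :
    ‖(N : ℂ) ^ (z - s)‖ = (N : ℝ) ^ (z.re - s.re) := by
  rw [Complex.norm_natCast_cpow_of_pos (by omega), sub_re]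

/-- A zero of `ζ` with `Re z ≥ 1/4` is a non-trivial zero. [folklore] -/
theorem mem_ntz_of_zero {z : ℂ} (h0 : riemannZeta z = 0) (hre : 1 / 4 ≤ z.re) :
    z ∈ ZetaZeros.riemannZetaNontrivialZeros :=
  ZetaZeros.riemannZetaNontrivialZeros.mem_iff'.2
    ⟨h0, by linarith, re_lt_one_of_riemannZeta_eq_zero h0⟩

/-- Under RH, `zetaInv` is analytic at every point with `Re z ≥ 1/4` that is not a non-trivial zero
(at `z = 1` the singularity is removable). [folklore] -/
theorem analyticAt_zetaInv (hRH : RiemannHypothesis) {z : ℂ} (hre : 1 / 4 ≤ z.re)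
    (hz : z ∉ ZetaZeros.riemannZetaNontrivialZeros) : AnalyticAt ℂ zetaInv z := by
  by_cases h1 : z = 1
  · subst h1
    exact (MertensBoundRH.differentiableOn_zetaInv hRH).analyticAt
      ((isOpen_lt continuous_const Complex.continuous_re).mem_nhds (by simp; norm_num))
  · have hζ : riemannZeta z ≠ 0 := fun h0 ↦ hz (mem_ntz_of_zero h0 hre)
    have han : AnalyticAt ℂ (fun w ↦ (riemannZeta w)⁻¹) z :=
      (analyticOn_riemannZeta z h1).inv hζ
    refine han.congr ?_
    filter_upwards [isOpen_compl_singleton.mem_nhds h1] with w hw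
    exact (zetaInv_of_ne_one hw).symm

/-- Under RH, `Φ_{N,s}` is analytic at every `z ≠ s` with `Re z ≥ 1/4` off the non-trivial zeros. [folklore] -/
theorem analyticAt_perronIntegrand (hRH : RiemannHypothesis) {N : ℕ} (hN : 2 ≤ N) (s : ℂ) {z : ℂ}
    (hre : 1 / 4 ≤ z.re) (hz : z ∉ ZetaZeros.riemannZetaNontrivialZeros) (hzs : z ≠ s) :
    AnalyticAt ℂ (perronIntegrand N s) z := by
  have h1 : AnalyticAt ℂ (fun z : ℂ ↦ (N : ℂ) ^ (z - s)) z :=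
    (differentiable_natCast_cpow_sub hN s).analyticAt z
  have h2 := analyticAt_zetaInv hRH hre hz
  have h3 : AnalyticAt ℂ (fun z : ℂ ↦ (z - s) ^ 2) z := (analyticAt_id.sub analyticAt_const).pow 2
  exact (h1.mul h2).div h3 (pow_ne_zero 2 (sub_ne_zero.2 hzs))

/-- The norm of the term at a zero: `‖N^{ρ−s}/(ζ'(ρ)(ρ−s)²)‖ = N^{1/2−Re s}/(|ζ'(ρ)| |ρ−s|²)` under RH.
[folklore] -/
theorem norm_zeroTerm (hRH : RiemannHypothesis) {N : ℕ} (hN : 2 ≤ N) (s : ℂ) {ρ : ℂ}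
    (hρ : ρ ∈ ZetaZeros.riemannZetaNontrivialZeros) :
    ‖(N : ℂ) ^ (ρ - s) / (deriv riemannZeta ρ * (ρ - s) ^ 2)‖ =
      (N : ℝ) ^ (1 / 2 - s.re) * (1 / (‖deriv riemannZeta ρ‖ * ‖ρ - s‖ ^ 2)) := by
  rw [norm_div, norm_mul, norm_pow, norm_natCast_cpow_sub hN, ntz_re hRH hρ]
  ring

/-- Summability and bound of the terms at the zeros (Lemma 3): for `0 < |Re s − 1/2| ≤ 1`,
`∑_ρ ‖N^{ρ−s}/(ζ'(ρ)(ρ−s)²)‖ ≤ N^{1/2−Re s} K |Re s − 1/2|⁻² (1+|Im s|)^{3/4−δ/4}`, with `K` the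
constant of `BCF.exists_lemma3`. [cite: BettinConreyFarmer2013, §3, Lemma 3] -/
theorem summable_norm_zeroTerm (hRH : RiemannHypothesis) {δ K : ℝ}
    (hK : ∀ ε : ℝ, 0 < ε → ε ≤ 1 → ∀ s : ℂ, ε ≤ |s.re - 1 / 2| → |s.re - 1 / 2| ≤ 1 →
      ∀ F : Finset ℂ, (∀ ρ ∈ F, ρ ∈ ZetaZeros.riemannZetaNontrivialZeros) →
        ∑ ρ ∈ F, 1 / (‖deriv riemannZeta ρ‖ * ‖ρ - s‖ ^ 2) ≤
          K * ε⁻¹ ^ 2 * (1 + |s.im|) ^ (3 / 4 - δ / 4))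
    {N : ℕ} (hN : 2 ≤ N) {s : ℂ} (hs : s.re ≠ 1 / 2) (hs1 : |s.re - 1 / 2| ≤ 1) :
    Summable (fun ρ : ZetaZeros.riemannZetaNontrivialZeros ↦
      ‖(N : ℂ) ^ ((ρ : ℂ) - s) / (deriv riemannZeta ρ * ((ρ : ℂ) - s) ^ 2)‖) ∧
    ∑' ρ : ZetaZeros.riemannZetaNontrivialZeros,
      ‖(N : ℂ) ^ ((ρ : ℂ) - s) / (deriv riemannZeta ρ * ((ρ : ℂ) - s) ^ 2)‖ ≤
      (N : ℝ) ^ (1 / 2 - s.re) * (K * |s.re - 1 / 2|⁻¹ ^ 2 * (1 + |s.im|) ^ (3 / 4 - δ / 4)) := by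
  classical
  have hε : 0 < |s.re - 1 / 2| := abs_pos.2 (sub_ne_zero.2 hs)
  have hbound := hK |s.re - 1 / 2| hε hs1 s le_rfl hs1
  set f : ℂ → ℝ := fun ρ ↦ ‖(N : ℂ) ^ (ρ - s) / (deriv riemannZeta ρ * (ρ - s) ^ 2)‖ with hf
  have hf0 : ∀ ρ, 0 ≤ f ρ := fun ρ ↦ norm_nonneg _
  have hpartial : ∀ u : Finset ZetaZeros.riemannZetaNontrivialZeros, ∑ x ∈ u, f x ≤
      (N : ℝ) ^ (1 / 2 - s.re) * (K * |s.re - 1 / 2|⁻¹ ^ 2 * (1 + |s.im|) ^ (3 / 4 - δ / 4)) := by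
    intro u
    set F : Finset ℂ := u.map (Function.Embedding.subtype _) with hF
    have hsumF : ∑ x ∈ u, f (x : ℂ) = ∑ ρ ∈ F, f ρ := by rw [hF, Finset.sum_map]; rfl
    have hFmem : ∀ ρ ∈ F, ρ ∈ ZetaZeros.riemannZetaNontrivialZeros := by
      intro ρ hρ
      rw [hF, Finset.mem_map] at hρ
      obtain ⟨x, -, rfl⟩ := hρ
      exact x.2
    rw [hsumF]
    have heq : ∑ ρ ∈ F, f ρ = (N : ℝ) ^ (1 / 2 - s.re) *
        ∑ ρ ∈ F, 1 / (‖deriv riemannZeta ρ‖ * ‖ρ - s‖ ^ 2) := by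
      rw [Finset.mul_sum]
      exact Finset.sum_congr rfl fun ρ hρ ↦ norm_zeroTerm hRH hN s (hFmem ρ hρ)
    rw [heq]
    exact mul_le_mul_of_nonneg_left (hbound F hFmem) (Real.rpow_nonneg (Nat.cast_nonneg N) _)
  have hsum : Summable fun ρ : ZetaZeros.riemannZetaNontrivialZeros ↦ f ρ :=
    summable_of_sum_le (fun ρ ↦ hf0 ρ) hpartial
  exact ⟨hsum, hsum.tsum_le_of_sum_le hpartial⟩

/-! ## The residues -/

/-- `ψ_s(z) = N^{z−s} ζ(z)⁻¹`, so that `Φ_{N,s} = ψ_s/(z−s)²` (double pole at `z = s`). [folklore] -/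
def psiS (N : ℕ) (s : ℂ) : ℂ → ℂ := fun z ↦ (N : ℂ) ^ (z - s) * zetaInv z

/-- The residues of `Φ_{N,s}`: `ψ_s'(s)` at `z = s`, and `N^{ρ−s}/(ζ'(ρ)(ρ−s)²)` at a simple zero `ρ`.
[cite: BettinConreyFarmer2013, §3, proof of Lemma 2] -/
def residueFn (N : ℕ) (s : ℂ) : ℂ → ℂ := fun p ↦
  if p = s then deriv (psiS N s) s else (N : ℂ) ^ (p - s) / (deriv riemannZeta p * (p - s) ^ 2)

/-- The pole set of `Φ_{N,s}`: `s` and the non-trivial zeros. [folklore] -/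
def poleSet (s : ℂ) : Set ℂ := ({s} : Set ℂ) ∪ ZetaZeros.riemannZetaNontrivialZeros

/-- `Φ_{N,s}(z) = ψ_s(z)/(z − s)²`. [folklore] -/
theorem perronIntegrand_eq (N : ℕ) (s z : ℂ) : perronIntegrand N s z = psiS N s z / (z - s) ^ 2 := rfl

/-- **The residues sum to `ψ_s'(s) + Z_N(s)`** over the pole set (absolutely), when `s` is not a
zero and the terms at the zeros are summable. [cite: BettinConreyFarmer2013, §3, proof of Lemma 2] -/
theorem hasSum_residueFn {N : ℕ} {s : ℂ} (hs : s ∉ ZetaZeros.riemannZetaNontrivialZeros)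
    (hZ : Summable fun ρ : ZetaZeros.riemannZetaNontrivialZeros ↦
      (N : ℂ) ^ ((ρ : ℂ) - s) / (deriv riemannZeta ρ * ((ρ : ℂ) - s) ^ 2)) :
    HasSum (residueFn N s ∘ ((↑) : poleSet s → ℂ)) (deriv (psiS N s) s + zeroSum N s) := by
  have hdisj : Disjoint ({s} : Set ℂ) ZetaZeros.riemannZetaNontrivialZeros :=
    Set.disjoint_singleton_left.2 hs
  have h1 : ∀ ρ : ZetaZeros.riemannZetaNontrivialZeros, residueFn N s ρ =
      (N : ℂ) ^ ((ρ : ℂ) - s) / (deriv riemannZeta ρ * ((ρ : ℂ) - s) ^ 2) := by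
    intro ρ
    have : (ρ : ℂ) ≠ s := fun h ↦ hs (h ▸ ρ.2)
    simp only [residueFn, if_neg this]
  have hZ' : HasSum (residueFn N s ∘ ((↑) : ZetaZeros.riemannZetaNontrivialZeros → ℂ))
      (zeroSum N s) := by
    have e : zeroSum N s = ∑' ρ : ZetaZeros.riemannZetaNontrivialZeros, residueFn N s ρ :=
      (tsum_congr h1).symm
    rw [e]
    exact (hZ.congr fun ρ ↦ (h1 ρ).symm).hasSum
  have hS : HasSum (residueFn N s ∘ ((↑) : ({s} : Set ℂ) → ℂ)) (deriv (psiS N s) s) := by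
    rw [hasSum_subtype_iff_indicator]
    have h := hasSum_single (f := Set.indicator ({s} : Set ℂ) (residueFn N s)) s (fun b hb ↦ by
      rw [Set.indicator_of_notMem]; simpa using hb)
    have e : Set.indicator ({s} : Set ℂ) (residueFn N s) s = deriv (psiS N s) s := by
      rw [Set.indicator_of_mem (Set.mem_singleton s)]
      simp [residueFn]
    rwa [e] at h
  exact hS.add_disjoint hdisj hZ'

/-- The derivative `ψ_s'(s) = log N/ζ(s) − ζ'(s)/ζ(s)²` (for `ζ(s) ≠ 0`, `s ≠ 1`). [cite: BettinConreyFarmer2013, §3, proof of Lemma 2] -/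
theorem deriv_psiS {N : ℕ} (hN : 2 ≤ N) {s : ℂ} (hs1 : s ≠ 1) (hζ : riemannZeta s ≠ 0) :
    deriv (psiS N s) s = (Real.log N : ℂ) / riemannZeta s - deriv riemannZeta s / riemannZeta s ^ 2 := by
  have hN0 : (N : ℂ) ≠ 0 := by exact_mod_cast (show N ≠ 0 by omega)
  have h1 : HasDerivAt (fun z : ℂ ↦ (N : ℂ) ^ (z - s)) ((N : ℂ) ^ (s - s) * Complex.log N * 1) s :=
    ((hasDerivAt_id s).sub_const s).const_cpow (Or.inl hN0)
  rw [sub_self, Complex.cpow_zero, one_mul, mul_one] at h1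
  have h2 : HasDerivAt zetaInv (-deriv riemannZeta s / riemannZeta s ^ 2) s := by
    have h := (differentiableAt_riemannZeta hs1).hasDerivAt.inv hζ
    refine h.congr_of_eventuallyEq ?_
    filter_upwards [isOpen_compl_singleton.mem_nhds hs1] with w hw
    exact zetaInv_of_ne_one hw
  have h3 := h1.fun_mul h2
  show deriv (fun z ↦ (N : ℂ) ^ (z - s) * zetaInv z) s = _
  rw [h3.deriv, sub_self, Complex.cpow_zero, one_mul, zetaInv_of_ne_one hs1, Complex.natCast_log]
  field_simp
  ring

/-! ## Pole data -/

/-- The open set `{z ≠ 1, ζ(z) ≠ 0}`. [folklore] -/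
theorem isOpen_zeta_ne_zero : IsOpen {z : ℂ | z ≠ 1 ∧ riemannZeta z ≠ 0} := by
  have hcont : ContinuousOn riemannZeta {z : ℂ | z ≠ 1} := fun z hz ↦
    (differentiableAt_riemannZeta hz).continuousAt.continuousWithinAt
  have h := hcont.isOpen_inter_preimage isOpen_ne (t := {w : ℂ | w ≠ 0}) isOpen_ne
  have e : {z : ℂ | z ≠ 1 ∧ riemannZeta z ≠ 0} = {z : ℂ | z ≠ 1} ∩ riemannZeta ⁻¹' {w | w ≠ 0} := by
    ext z; simp
  rw [e]; exact h

/-- **Pole data at `z = s`**: `Φ_{N,s} = ψ_s/(z−s)²` with `ψ_s` differentiable near `s`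
(`ζ(s) ≠ 0`, `s ≠ 1`). [folklore] -/
theorem poleData_s {N : ℕ} (hN : 2 ≤ N) {s : ℂ} (hs1 : s ≠ 1) (hζ : riemannZeta s ≠ 0) :
    ∃ φ : ℂ → ℂ, ∃ V ∈ 𝓝 s, DifferentiableOn ℂ φ V ∧ deriv φ s = residueFn N s s ∧
      ∀ z ∈ V, z ≠ s → perronIntegrand N s z = φ z / (z - s) ^ 2 := by
  refine ⟨psiS N s, {z : ℂ | z ≠ 1 ∧ riemannZeta z ≠ 0}, isOpen_zeta_ne_zero.mem_nhds ⟨hs1, hζ⟩,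
    ?_, by simp [residueFn], fun z _ _ ↦ rfl⟩
  intro z hz
  refine DifferentiableAt.differentiableWithinAt ?_
  have h2 : DifferentiableAt ℂ zetaInv z := by
    refine ((differentiableAt_riemannZeta hz.1).inv hz.2).congr_of_eventuallyEq ?_
    filter_upwards [isOpen_compl_singleton.mem_nhds hz.1] with w hw
    exact zetaInv_of_ne_one hw
  exact (differentiable_natCast_cpow_sub hN s z).mul h2

/-- **Pole data at a simple zero `ρ ≠ s`**: `Φ_{N,s} = φ/(z−ρ)²` near `ρ` with
`φ'(ρ) = N^{ρ−s}/(ζ'(ρ)(ρ−s)²)` (via `ζ(z) = (z−ρ)·dslope ζ ρ z`). [cite: BettinConreyFarmer2013, §3, proof of Lemma 2] -/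
theorem poleData_zero {N : ℕ} (hN : 2 ≤ N) {s ρ : ℂ} (hρ : ρ ∈ ZetaZeros.riemannZetaNontrivialZeros)
    (hρs : ρ ≠ s) (hsimple : deriv riemannZeta ρ ≠ 0) :
    ∃ φ : ℂ → ℂ, ∃ V ∈ 𝓝 ρ, DifferentiableOn ℂ φ V ∧ deriv φ ρ = residueFn N s ρ ∧
      ∀ z ∈ V, z ≠ ρ → perronIntegrand N s z = φ z / (z - ρ) ^ 2 := by
  obtain ⟨h0, -, -⟩ := ZetaZeros.riemannZetaNontrivialZeros.mem_iff'.1 hρ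
  have hρ1 : ρ ≠ 1 := ne_one_of_riemannZeta_eq_zero h0
  set q := dslope riemannZeta ρ with hq
  have hqρ : q ρ = deriv riemannZeta ρ := by rw [hq, dslope_same]
  have hqdiff : DifferentiableOn ℂ q {z : ℂ | z ≠ 1} :=
    (differentiableOn_dslope (isOpen_compl_singleton.mem_nhds hρ1)).2
      fun z hz ↦ (differentiableAt_riemannZeta hz).differentiableWithinAt
  have hqcont : ContinuousOn q {z : ℂ | z ≠ 1} := hqdiff.continuousOn
  -- the neighbourhood
  set V : Set ℂ := ({z : ℂ | z ≠ 1} ∩ q ⁻¹' {w | w ≠ 0}) ∩ {z | z ≠ s} with hV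
  have hVo : IsOpen V :=
    (hqcont.isOpen_inter_preimage isOpen_ne isOpen_ne).inter isOpen_ne
  have hρV : ρ ∈ V := ⟨⟨hρ1, by show q ρ ≠ 0; rwa [hqρ]⟩, hρs⟩
  -- the simple-pole numerator
  set ψ : ℂ → ℂ := fun z ↦ (N : ℂ) ^ (z - s) / (z - s) ^ 2 * (q z)⁻¹ with hψ
  have hψdiff : DifferentiableOn ℂ ψ V := by
    intro z hz
    refine DifferentiableAt.differentiableWithinAt ?_
    have hz1 : z ≠ 1 := hz.1.1
    have hqz : q z ≠ 0 := hz.1.2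
    have hzs : z ≠ s := hz.2
    have hqd : DifferentiableAt ℂ q z := hqdiff.differentiableAt (isOpen_ne.mem_nhds hz1)
    exact ((differentiable_natCast_cpow_sub hN s z).div ((differentiableAt_id.sub_const s).pow 2)
      (pow_ne_zero 2 (sub_ne_zero.2 hzs))).mul (hqd.inv hqz)
  have hF : ∀ z ∈ V, z ≠ ρ → perronIntegrand N s z = ψ z / (z - ρ) := by
    intro z hz hzρ
    have hz1 : z ≠ 1 := hz.1.1
    have hqz : q z ≠ 0 := hz.1.2
    have hfac : riemannZeta z = (z - ρ) * q z := by
      have h := sub_smul_dslope riemannZeta ρ z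
      rw [h0, sub_zero, smul_eq_mul] at h
      exact h.symm
    rw [perronIntegrand, zetaInv_of_ne_one hz1, hfac, hψ]
    field_simp [sub_ne_zero.2 hzρ]
  obtain ⟨φ, W, hW, hφ, hderiv, hFφ⟩ :=
    Literature.Analysis.Complex.doublePole_data_of_simplePole (hVo.mem_nhds hρV) hψdiff hF
  refine ⟨φ, W, hW, hφ, ?_, hFφ⟩
  rw [hderiv, residueFn, if_neg hρs, hψ]
  simp only
  rw [hqρ]
  field_simp

/-! ## Decay on the horizontal segments at very good heights -/

/-- If `‖ζ(x ± iT)⁻¹‖ ≤ T` and `T ≥ 2|Im s| + 2`, then `‖Φ_{N,s}(x ± iT)‖ ≤ 4N/T` for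
`x ≤ Re s + 1` (`N ≥ 2`). [cite: BettinConreyFarmer2013, §3, proof of Lemma 2] -/
theorem norm_perronIntegrand_horizontal_le {N : ℕ} (hN : 2 ≤ N) {s : ℂ}
    {T : ℝ} (hT : 2 * |s.im| + 2 ≤ T) {x y : ℝ} (hx : x ≤ s.re + 1) (hy : |y| = T)
    (hinv : ‖(riemannZeta (x + y * I))⁻¹‖ ≤ T) :
    ‖perronIntegrand N s (x + y * I)‖ ≤ 4 * N / T := by
  have hTpos : 0 < T := by linarith [abs_nonneg s.im]
  have hN1 : (1 : ℝ) ≤ N := by exact_mod_cast (show 1 ≤ N by omega)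
  set z : ℂ := x + y * I with hz
  have hzre : z.re = x := by simp [hz]
  have hzim : z.im = y := by simp [hz]
  have hy0 : y ≠ 0 := fun h ↦ by rw [h, abs_zero] at hy; linarith
  have hz1 : z ≠ 1 := by
    intro h; have := congrArg Complex.im h
    rw [hzim, one_im] at this
    exact hy0 this
  have hzs' : T / 2 ≤ ‖z - s‖ := by
    have h1 : |z.im - s.im| ≤ ‖z - s‖ := by
      have := Complex.abs_im_le_norm (z - s); simpa using this
    have h2 : |z.im| - |s.im| ≤ |z.im - s.im| := abs_sub_abs_le_abs_sub _ _
    rw [hzim, hy] at h2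
    rw [hzim] at h1
    linarith [abs_nonneg s.im]
  have hN' : ‖(N : ℂ) ^ (z - s)‖ ≤ N := by
    rw [norm_natCast_cpow_sub hN, hzre]
    calc (N : ℝ) ^ (x - s.re) ≤ (N : ℝ) ^ (1 : ℝ) :=
          Real.rpow_le_rpow_of_exponent_le hN1 (by linarith)
      _ = N := Real.rpow_one _
  rw [perronIntegrand, zetaInv_of_ne_one hz1, norm_div, norm_mul, norm_pow]
  have hzs0 : 0 < ‖z - s‖ := by linarith
  have hpos : 0 < ‖z - s‖ ^ 2 := pow_pos hzs0 2
  rw [div_le_iff₀ hpos]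
  have h4 : T ^ 2 / 4 ≤ ‖z - s‖ ^ 2 := by nlinarith
  calc ‖(N : ℂ) ^ (z - s)‖ * ‖(riemannZeta z)⁻¹‖ ≤ N * T :=
        mul_le_mul hN' hinv (norm_nonneg _) (Nat.cast_nonneg N)
    _ = 4 * N / T * (T ^ 2 / 4) := by field_simp
    _ ≤ 4 * N / T * ‖z - s‖ ^ 2 := mul_le_mul_of_nonneg_left h4 (by positivity)

/-! ## The two vertical lines -/

/-- `‖ζ(z)⁻¹‖ ≤ ∑ n^{-Re z}` for `Re z > 1` (from `ζ⁻¹ = ∑ μ(n) n^{-z}`). [folklore] -/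
theorem norm_inv_zeta_le_tsum {z : ℂ} (hz : 1 < z.re) :
    ‖(riemannZeta z)⁻¹‖ ≤ ∑' n : ℕ, (n : ℝ) ^ (-z.re) := by
  rw [← RieszPerron.LSeries_moebius_eq_inv hz, LSeries]
  have hs : LSeriesSummable (fun n : ℕ ↦ ((ArithmeticFunction.moebius n : ℤ) : ℂ)) z :=
    ArithmeticFunction.LSeriesSummable_moebius_iff.2 hz
  have hle : ∀ n : ℕ, ‖LSeries.term (fun n : ℕ ↦ ((ArithmeticFunction.moebius n : ℤ) : ℂ)) z n‖ ≤
      (n : ℝ) ^ (-z.re) := by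
    intro n
    rw [LSeries.norm_term_eq]
    split_ifs with hn
    · exact Real.rpow_nonneg (Nat.cast_nonneg n) _
    · rw [Real.rpow_neg (Nat.cast_nonneg n), div_eq_mul_inv]
      exact mul_le_of_le_one_left (by positivity) (RieszPerron.norm_moebius_le n)
  have hsum' : Summable fun n : ℕ ↦ (n : ℝ) ^ (-z.re) := Real.summable_nat_rpow.2 (by linarith)
  exact (norm_tsum_le_tsum_norm hs.norm).trans (hs.norm.tsum_le_tsum hle hsum')

/-- Continuity of `y ↦ Φ_{N,s}(x + iy)` on a line `Re z = x ≥ 1/4` containing no pole (under RH: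
`x ≠ 1/2`, `x ≠ Re s`). [folklore] -/
theorem continuous_perronIntegrand_vertical (hRH : RiemannHypothesis) {N : ℕ} (hN : 2 ≤ N) (s : ℂ)
    {x : ℝ} (hx : 1 / 4 ≤ x) (hx2 : x ≠ 1 / 2) (hxs : x ≠ s.re) :
    Continuous fun y : ℝ ↦ perronIntegrand N s (x + y * I) := by
  refine continuous_iff_continuousAt.2 fun y ↦ ?_
  have hz : ((x : ℂ) + y * I) ∉ ZetaZeros.riemannZetaNontrivialZeros := fun h ↦ by
    have := ntz_re hRH h; simp at this; exact hx2 (by rw [this]; norm_num)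
  have hzs : ((x : ℂ) + y * I) ≠ s := fun h ↦ by
    have := congrArg Complex.re h; simp at this; exact hxs this
  exact (analyticAt_perronIntegrand hRH hN s (by simpa using hx) hz hzs).continuousAt.comp
    (f := fun y : ℝ ↦ (x : ℂ) + y * I) (by fun_prop)

/-- **The left line `Re z = 1/4`.** Under RH, for `3/8 ≤ Re s`: `y ↦ Φ_{N,s}(1/4 + iy)` is
integrable and `‖Φ_{N,s}(1/4+iy)‖ ≤ 64 B_q N^{1/4 − Re s} (1 + (y − Im s)²)⁻¹`, `B_q` the bound of
`1/ζ` on that line. [cite: BettinConreyFarmer2013, §3, proof of Lemma 2] -/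
theorem left_line (hRH : RiemannHypothesis) {N : ℕ} (hN : 2 ≤ N) {s : ℂ} (hσ : 3 / 8 ≤ s.re)
    {Bq : ℝ} (hBq : ∀ t : ℝ, ‖(riemannZeta (1 / 4 + t * I))⁻¹‖ ≤ Bq) :
    (∀ y : ℝ, ‖perronIntegrand N s (((1 / 4 : ℝ) : ℂ) + y * I)‖ ≤
      64 * Bq * (N : ℝ) ^ (1 / 4 - s.re) * (1 + (y - s.im) ^ 2)⁻¹) ∧
    Integrable fun y : ℝ ↦ perronIntegrand N s (((1 / 4 : ℝ) : ℂ) + y * I) := by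
  have hq : ((1 / 4 : ℝ) : ℂ) = 1 / 4 := by push_cast; ring
  have hBq0 : 0 ≤ Bq := (norm_nonneg _).trans (hBq 0)
  have hbound : ∀ y : ℝ, ‖perronIntegrand N s (((1 / 4 : ℝ) : ℂ) + y * I)‖ ≤
      64 * Bq * (N : ℝ) ^ (1 / 4 - s.re) * (1 + (y - s.im) ^ 2)⁻¹ := by
    intro y
    set z : ℂ := ((1 / 4 : ℝ) : ℂ) + y * I with hz
    have hz1 : z ≠ 1 := by
      intro h; have := congrArg Complex.re h; simp [hz] at this
    have hzre : z.re = 1 / 4 := by simp [hz]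
    have hlow : (1 / 64) * (1 + (y - s.im) ^ 2) ≤ ‖z - s‖ ^ 2 := by
      have hsq : ‖z - s‖ ^ 2 = (1 / 4 - s.re) ^ 2 + (y - s.im) ^ 2 := by
        rw [← Complex.normSq_eq_norm_sq, Complex.normSq_apply]; simp [hz]; ring
      rw [hsq]
      nlinarith [sq_nonneg (y - s.im)]
    have hpos : 0 < ‖z - s‖ ^ 2 := lt_of_lt_of_le (by positivity) hlow
    rw [perronIntegrand, zetaInv_of_ne_one hz1, norm_div, norm_mul, norm_pow,
      norm_natCast_cpow_sub hN, hzre, div_le_iff₀ hpos]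
    have hζ : ‖(riemannZeta z)⁻¹‖ ≤ Bq := by rw [hz, hq]; exact hBq y
    have hNp : 0 ≤ (N : ℝ) ^ (1 / 4 - s.re) := Real.rpow_nonneg (Nat.cast_nonneg N) _
    calc (N : ℝ) ^ (1 / 4 - s.re) * ‖(riemannZeta z)⁻¹‖ ≤ (N : ℝ) ^ (1 / 4 - s.re) * Bq :=
          mul_le_mul_of_nonneg_left hζ hNp
      _ = 64 * Bq * (N : ℝ) ^ (1 / 4 - s.re) * (1 + (y - s.im) ^ 2)⁻¹ *
            ((1 / 64) * (1 + (y - s.im) ^ 2)) := by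
          field_simp
      _ ≤ 64 * Bq * (N : ℝ) ^ (1 / 4 - s.re) * (1 + (y - s.im) ^ 2)⁻¹ * ‖z - s‖ ^ 2 :=
          mul_le_mul_of_nonneg_left hlow (by positivity)
  refine ⟨hbound, ?_⟩
  have hcont : Continuous fun y : ℝ ↦ perronIntegrand N s (((1 / 4 : ℝ) : ℂ) + y * I) :=
    continuous_perronIntegrand_vertical hRH hN s le_rfl (by norm_num) (by linarith)
  have hint : Integrable fun y : ℝ ↦ 64 * Bq * (N : ℝ) ^ (1 / 4 - s.re) * (1 + (y - s.im) ^ 2)⁻¹ :=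
    ((integrable_inv_one_add_sq.comp_sub_right s.im).const_mul _)
  exact hint.mono' hcont.aestronglyMeasurable (Eventually.of_forall hbound)

/-- **The right line `Re z = Re s + 1`.** For `Re s > 0`: `y ↦ Φ_{N,s}(Re s + 1 + iy)` is
integrable (`‖Φ‖ ≤ N ζ₀ (1 + (y − Im s)²)⁻¹` with `ζ₀ = ∑ n^{−Re s − 1}`). [cite: BettinConreyFarmer2013, §3, proof of Lemma 2] -/
theorem right_line (hRH : RiemannHypothesis) {N : ℕ} (hN : 2 ≤ N) {s : ℂ} (hσ : 1 / 4 < s.re) :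
    Integrable fun y : ℝ ↦ perronIntegrand N s (((s.re + 1 : ℝ) : ℂ) + y * I) := by
  set ζ₀ : ℝ := ∑' n : ℕ, (n : ℝ) ^ (-(s.re + 1)) with hζ₀
  have hbound : ∀ y : ℝ, ‖perronIntegrand N s (((s.re + 1 : ℝ) : ℂ) + y * I)‖ ≤
      N * ζ₀ * (1 + (y - s.im) ^ 2)⁻¹ := by
    intro y
    set z : ℂ := ((s.re + 1 : ℝ) : ℂ) + y * I with hz
    have hzre : z.re = s.re + 1 := by simp [hz]
    have hz1 : z ≠ 1 := by
      intro h; have := congrArg Complex.re h; rw [hzre, one_re] at this; linarith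
    have hre1 : 1 < z.re := by rw [hzre]; linarith
    have hsq : ‖z - s‖ ^ 2 = 1 + (y - s.im) ^ 2 := by
      rw [← Complex.normSq_eq_norm_sq, Complex.normSq_apply]; simp [hz]; ring
    have hpos : 0 < ‖z - s‖ ^ 2 := by rw [hsq]; positivity
    rw [perronIntegrand, zetaInv_of_ne_one hz1, norm_div, norm_mul, norm_pow,
      norm_natCast_cpow_sub hN, hzre, hsq, div_eq_mul_inv]
    have hζ : ‖(riemannZeta z)⁻¹‖ ≤ ζ₀ := by
      have := norm_inv_zeta_le_tsum hre1; rwa [hzre] at this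
    have hNe : (N : ℝ) ^ (s.re + 1 - s.re) = N := by
      rw [show s.re + 1 - s.re = (1 : ℝ) by ring, Real.rpow_one]
    rw [hNe]
    exact mul_le_mul_of_nonneg_right (mul_le_mul_of_nonneg_left hζ (Nat.cast_nonneg N))
      (by positivity)
  have hcont : Continuous fun y : ℝ ↦ perronIntegrand N s (((s.re + 1 : ℝ) : ℂ) + y * I) :=
    continuous_perronIntegrand_vertical hRH hN s (by linarith) (by linarith) (by linarith)
  have hint : Integrable fun y : ℝ ↦ N * ζ₀ * (1 + (y - s.im) ^ 2)⁻¹ :=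
    ((integrable_inv_one_add_sq.comp_sub_right s.im).const_mul _)
  exact hint.mono' hcont.aestronglyMeasurable (Eventually.of_forall hbound)

/-- **Bound for the left-line term**: `‖E_N(s)‖ ≤ 32 B_q N^{1/4 − Re s}` for `3/8 ≤ Re s`
(`∫ (1 + (y−t)²)⁻¹ dy = π`). [cite: BettinConreyFarmer2013, §3, Lemma 2 (error term)] -/
theorem norm_leftLineTerm_le (hRH : RiemannHypothesis) {N : ℕ} (hN : 2 ≤ N) {s : ℂ} (hσ : 3 / 8 ≤ s.re)
    {Bq : ℝ} (hBq : ∀ t : ℝ, ‖(riemannZeta (1 / 4 + t * I))⁻¹‖ ≤ Bq) :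
    ‖leftLineTerm N s‖ ≤ 32 * Bq * (N : ℝ) ^ (1 / 4 - s.re) := by
  obtain ⟨hbound, hint⟩ := left_line hRH hN hσ hBq
  have hq : ((1 / 4 : ℝ) : ℂ) = 1 / 4 := by push_cast; ring
  have hBq0 : 0 ≤ Bq := (norm_nonneg _).trans (hBq 0)
  have hπ := Real.pi_pos
  have e : leftLineTerm N s = (1 / (2 * π) : ℂ) *
      ∫ y : ℝ, perronIntegrand N s (((1 / 4 : ℝ) : ℂ) + y * I) := by
    rw [leftLineTerm, hq]
  rw [e, norm_mul]
  have hn : ‖(1 / (2 * π) : ℂ)‖ = 1 / (2 * π) := by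
    rw [show (1 / (2 * π) : ℂ) = ((1 / (2 * π) : ℝ) : ℂ) by push_cast; ring, Complex.norm_real,
      Real.norm_eq_abs, abs_of_pos (by positivity)]
  rw [hn]
  have hI : ‖∫ y : ℝ, perronIntegrand N s (((1 / 4 : ℝ) : ℂ) + y * I)‖ ≤
      64 * Bq * (N : ℝ) ^ (1 / 4 - s.re) * π := by
    calc ‖∫ y : ℝ, perronIntegrand N s (((1 / 4 : ℝ) : ℂ) + y * I)‖
        ≤ ∫ y : ℝ, 64 * Bq * (N : ℝ) ^ (1 / 4 - s.re) * (1 + (y - s.im) ^ 2)⁻¹ :=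
          norm_integral_le_of_norm_le ((integrable_inv_one_add_sq.comp_sub_right s.im).const_mul _)
            (Eventually.of_forall hbound)
      _ = 64 * Bq * (N : ℝ) ^ (1 / 4 - s.re) * π := by
          rw [integral_const_mul]
          have := integral_sub_right_eq_self (μ := (volume : Measure ℝ)) (fun y : ℝ ↦ (1 + y ^ 2)⁻¹) s.im
          rw [this, integral_univ_inv_one_add_sq]
  calc 1 / (2 * π) * ‖∫ y : ℝ, perronIntegrand N s (((1 / 4 : ℝ) : ℂ) + y * I)‖
      ≤ 1 / (2 * π) * (64 * Bq * (N : ℝ) ^ (1 / 4 - s.re) * π) :=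
        mul_le_mul_of_nonneg_left hI (by positivity)
    _ = 32 * Bq * (N : ℝ) ^ (1 / 4 - s.re) := by field_simp; ring

/-! ## The explicit formula -/

/-- **Lemma 2 of [BettinConreyFarmer2013] under RH, truncated at `Re z = 1/4`.** Assume RH, that
all non-trivial zeros are simple, and condition (2) with `0 < δ ≤ 1`. For `N ≥ 2` and every `s`
with `3/8 ≤ Re s < 1`, `Re s ≠ 1/2`:
`log N · V_N(s) = log N / ζ(s) − ζ'(s)/ζ(s)² + Z_N(s) + E_N(s)`.
[cite: BettinConreyFarmer2013, §3, Lemma 2] -/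
theorem levinson_explicit (hRH : RiemannHypothesis)
    (hsimp : ∀ ρ : ℂ, riemannZeta ρ = 0 → 0 < ρ.re → ρ.re < 1 → deriv riemannZeta ρ ≠ 0)
    {δ C : ℝ} (hδ : 0 < δ) (hδ1 : δ ≤ 1)
    (hC : ∀ T : ℝ, 2 ≤ T →
      ∑ᶠ ρ ∈ zetaZeroBox 0 T, 1 / ‖deriv riemannZeta ρ‖ ^ 2 ≤ C * T ^ (3 / 2 - δ))
    {N : ℕ} (hN : 2 ≤ N) {s : ℂ} (hσ1 : 3 / 8 ≤ s.re) (hσ2 : s.re < 1) (hσ3 : s.re ≠ 1 / 2) :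
    (Real.log N : ℂ) * levinsonMollifier N s =
      (Real.log N : ℂ) / riemannZeta s - deriv riemannZeta s / riemannZeta s ^ 2 +
        zeroSum N s + leftLineTerm N s := by
  classical
  obtain ⟨K, -, hK⟩ := exists_lemma3 hRH hsimp hδ hδ1 hC
  obtain ⟨Bq, -, hBq⟩ := ZetaDerivReciprocalSeries.exists_bound_inv_zeta_quarter hRH
  -- basic facts about `s`
  have hs0 : 0 < s.re := by linarith
  have hs1 : s ≠ 1 := by
    intro h; rw [h, one_re] at hσ2; exact lt_irrefl _ hσ2
  have hζs : riemannZeta s ≠ 0 := riemannZeta_ne_zero_of_riemannHypothesis hRH hs0 hσ3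
  have hsntz : s ∉ ZetaZeros.riemannZetaNontrivialZeros := fun h ↦
    hζs (ZetaZeros.riemannZetaNontrivialZeros.mem_iff'.1 h).1
  have hab : (1 / 4 : ℝ) < s.re + 1 := by linarith
  -- (1) residues
  have hterms := summable_norm_zeroTerm hRH hK hN hσ3 (by rw [abs_le]; constructor <;> linarith)
  have hres : HasSum (fun p : poleSet s ↦ residueFn N s p) (deriv (psiS N s) s + zeroSum N s) :=
    hasSum_residueFn hsntz hterms.1.of_norm
  -- (2) very good heights
  obtain ⟨T₀, -, hVG⟩ := VeryGoodHeights.exists_norm_inv_zeta_le_rpow hRH one_pos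
  set A : ℝ := max T₀ (2 * |s.im| + 2) with hA
  have hchoice : ∀ n : ℕ, ∃ T ∈ Icc (A + n) (A + n + 1),
      (∀ ρ : ℂ, riemannZeta ρ = 0 → 1 / 4 ≤ ρ.re → ρ.im ≠ T ∧ ρ.im ≠ -T) ∧
      ∀ x ∈ Icc (1 / 4 : ℝ) 2, ‖(riemannZeta (x + T * I))⁻¹‖ ≤ T ^ (1 : ℝ) ∧
        ‖(riemannZeta (x - T * I))⁻¹‖ ≤ T ^ (1 : ℝ) := by
    intro n
    exact hVG (A + n) (by
      have h1 := le_max_left T₀ (2 * |s.im| + 2)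
      have h2 : (0 : ℝ) ≤ n := n.cast_nonneg
      linarith)
  choose T hTI hTord hTbd using hchoice
  have hTt : ∀ n, 2 * |s.im| + 2 ≤ T n := fun n ↦ by
    have h1 := (hTI n).1; have h2 := le_max_right T₀ (2 * |s.im| + 2)
    have h3 : (0 : ℝ) ≤ n := n.cast_nonneg
    linarith
  have hTpos : ∀ n, 0 < T n := fun n ↦ by linarith [hTt n, abs_nonneg s.im]
  have hTlim : Tendsto T atTop atTop := by
    refine tendsto_atTop_mono (fun n ↦ ?_) tendsto_natCast_atTop_atTop
    have h1 := (hTI n).1; have h2 := le_max_right T₀ (2 * |s.im| + 2)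
    linarith [abs_nonneg s.im]
  set dec : ℕ → ℝ := fun n ↦ 4 * N / T n with hdec
  have hdeclim : Tendsto dec atTop (𝓝 0) := by
    have h := (hTlim.inv_tendsto_atTop).const_mul (4 * (N : ℝ))
    rw [mul_zero] at h
    exact h.congr fun n ↦ by simp [hdec, div_eq_mul_inv]
  -- (3) the residue theorem between the two lines
  have hstrip := Literature.Analysis.Complex.integral_vertical_sub_eq_tsum_of_doublePoles
    (F := perronIntegrand N s) hab (poleSet s) (residueFn N s) ?_ ?_ ?_ ?_ hres.summable
    (left_line hRH hN hσ1 hBq).2 (right_line hRH hN (by linarith)) T dec hTlim hdeclim ?_ ?_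
  rotate_left
  · -- poles inside the open strip
    rintro p (hp | hp)
    · rw [Set.mem_singleton_iff] at hp; rw [hp]; constructor <;> linarith
    · rw [ntz_re hRH hp]; constructor <;> linarith
  · -- local finiteness
    intro M
    refine ((Set.finite_singleton s).union (ntz_finite_abs_im_le M)).subset ?_
    rintro p ⟨hp | hp, hM⟩
    · exact Or.inl hp
    · exact Or.inr ⟨hp, hM⟩
  · -- analyticity off the poles
    intro z hz1 _ hzP
    have hzs : z ≠ s := fun h ↦ hzP (Or.inl (by rw [h]; rfl))
    have hz : z ∉ ZetaZeros.riemannZetaNontrivialZeros := fun h ↦ hzP (Or.inr h)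
    exact analyticAt_perronIntegrand hRH hN s hz1 hz hzs
  · -- pole data
    rintro p (hp | hp)
    · rw [Set.mem_singleton_iff] at hp; rw [hp]
      exact poleData_s hN hs1 hζs
    · exact poleData_zero hN hp (fun h ↦ hsntz (h ▸ hp)) (ntz_deriv_ne_zero hsimp hp)
  · -- the truncation heights avoid the poles
    rintro n p (hp | hp)
    · rw [Set.mem_singleton_iff] at hp; rw [hp]
      intro h; linarith [hTt n, abs_nonneg s.im]
    · obtain ⟨h0, -, -⟩ := ZetaZeros.riemannZetaNontrivialZeros.mem_iff'.1 hp
      have hre : 1 / 4 ≤ p.re := by rw [ntz_re hRH hp]; norm_num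
      obtain ⟨h1, h2⟩ := hTord n p h0 hre
      intro h
      rcases abs_eq (hTpos n).le |>.1 h with h' | h'
      · exact h1 h'
      · exact h2 h'
  · -- decay on the horizontal segments
    intro n x hx
    have hx2 : x ∈ Icc (1 / 4 : ℝ) 2 := ⟨hx.1, by linarith [hx.2]⟩
    obtain ⟨hb1, hb2⟩ := hTbd n x hx2
    rw [Real.rpow_one] at hb1 hb2
    constructor
    · exact norm_perronIntegrand_horizontal_le hN (hTt n) hx.2 (abs_of_pos (hTpos n)) hb1
    · have e : (x : ℂ) - T n * I = x + ((-T n : ℝ) : ℂ) * I := by push_cast; ring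
      rw [e] at hb2 ⊢
      exact norm_perronIntegrand_horizontal_le hN (hTt n) hx.2
        (by rw [abs_neg, abs_of_pos (hTpos n)]) hb2
  -- (4) assemble
  rw [hres.tsum_eq, deriv_psiS hN hs1 hζs, integral_perronIntegrand_right hN hs0] at hstrip
  have hq : ((1 / 4 : ℝ) : ℂ) = 1 / 4 := by push_cast; ring
  have hE : leftLineTerm N s = (1 / (2 * π) : ℂ) *
      ∫ y : ℝ, perronIntegrand N s (((1 / 4 : ℝ) : ℂ) + y * I) := by
    rw [leftLineTerm, hq]
  set B := ∫ y : ℝ, perronIntegrand N s (((1 / 4 : ℝ) : ℂ) + y * I) with hB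
  have hπ : (π : ℂ) ≠ 0 := by exact_mod_cast Real.pi_ne_zero
  have hAB : 2 * π * ((Real.log N : ℂ) * levinsonMollifier N s) - B =
      2 * π * ((Real.log N : ℂ) / riemannZeta s - deriv riemannZeta s / riemannZeta s ^ 2 +
        zeroSum N s) := by
    apply mul_left_cancel₀ I_ne_zero
    linear_combination hstrip
  rw [hE]
  linear_combination (norm := skip) (1 / (2 * π) : ℂ) * hAB
  field_simp
  ring

end BCF

end Literature.NumberTheory.LFunctions

end
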